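import Summits.AtomisticToContinuum.Crystallization.Theorems.ThreeConeCertificateSlackRigidityPricedFloorsS3Defs2
import Summits.AtomisticToContinuum.Crystallization.Theorems.ThreeConeCertificateSlackRigidityPricedFloorsRootCake
import HarnessLib

/-!
# `SlackRigidity` (stmt-AtomisticToContinuum-11960), line `priced-floors-palm-exactification`, stub S3
# (`stub_layeredMeanSelection`): layer energies of re-rooted and reversed data, symmetric fault price

Lead c19, S3 energetics, part 3 (deterministic; in the data vocabulary of the S3 Defs modules).

* `reverse_fits` — REVERSING THE ORIENTATION: the data `(−T, a, m ↦ s(−m−1),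
  m ↦ −z(−m))` fit the same set as `(T, a, s, z)` (their pattern point `(m,i,j)` is the point
  `(−m,−i,−j)` of the original data);
* `two_mul_rootEnergy_fits` — the root layer cake in the `Fits` vocabulary;
* `competitorEnergy_reverse` — the COMPETITOR root energy `Φ₀(a) + Σ'_{m≠0} Φ(z m, L_alt m)` is the
  same for the reversed data (`Φ` is even in the height, `L_alt` is even in the index);
* `lms_fault_price_symmetric` (registered) — SYMMETRIC FAULT PRICE: for data fitting `S`,
  `c₀ · (1[s 1 ≠ −s 0] + 1[s(−1) ≠ −s(−2)]) ≤ 2 · (2h(count|S) − competitor energy)`, i.e. both the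
  layer above and the layer below the root are charged (the price of `lms_fault_price_root` for the
  data and for the reversed data);
* `two_mul_rootEnergy_reroot` — LAYER `k` SEEN FROM ITS OWN POINTS: twice the root energy of the set
  re-rooted at a point of layer `k` is the layer-`k` energy
  `Φ₀(a) + Σ'_{m'≠k} Φ(z m' − z k, L m' − L k)` of the window sums of `lms_window_sum_ge`;
* `competitorEnergy_reroot` — the same for the competitor (alternating word): the competitor energy of
  the re-rooted data is the layer-`k` term of the competitor's window sum.

All `[folklore]` bookkeeping over landed lemmas.
-/

noncomputable section

open MeasureTheory Filter Set
open scoped ENNReal BigOperators Topology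

namespace Summit.AtomisticToContinuum.Crystallization.Theorems.SlackRigidityPricedFloorsLayerEnergy

open Literature.Probability.Process
open Literature.MathematicalPhysics.StatisticalMechanics
open Summit.AtomisticToContinuum.Crystallization.Theorems.SlackRigidityPricedFloors
open Summit.AtomisticToContinuum.Crystallization.Theorems.SlackRigidityPricedFloorsRootCake
open Summit.AtomisticToContinuum.Crystallization.Theorems.LayeredHull

/-! ## Reversing the orientation of the layer index -/

/-- **The reversed data fit the same set.** [folklore] -/
theorem reverse_fits {S : Set E3} {e : LData} (he : Fits S e) :
    Fits S (-e.1, e.2.1, fun k => e.2.2.1 (-k - 1), fun k => -e.2.2.2 (-k)) := by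
  obtain ⟨⟨hT, ⟨ha, ha1, hs, hz⟩, hz0⟩, hS⟩ := he
  -- labels of the reversed word (`= PrestressSplitKorn.haggLabel_reflect`, kept local to avoid the import)
  have haggLabel_reverse : ∀ (s : ℤ → ℤ) (m : ℤ), haggLabel (fun k => s (-k - 1)) m = -haggLabel s (-m) := by
    intro s m
    induction m using Int.induction_on with
    | zero => simp
    | succ n ih =>
      rw [haggLabel_succ, ih]
      have h := haggLabel_succ s (-((n : ℤ) + 1))
      rw [show -((n : ℤ) + 1) + 1 = -(n : ℤ) by ring] at h
      rw [h]
      ring_nf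
    | pred n ih =>
      have h1 := haggLabel_succ (fun k => s (-k - 1)) (-(n : ℤ) - 1)
      rw [show -(n : ℤ) - 1 + 1 = -(n : ℤ) by ring] at h1
      have h2 := haggLabel_succ s (n : ℤ)
      rw [show -(-(n : ℤ) - 1) = (n : ℤ) + 1 by ring]
      have : haggLabel (fun k => s (-k - 1)) (-(n : ℤ) - 1) =
          haggLabel (fun k => s (-k - 1)) (-(n : ℤ)) - s (-(-(n : ℤ) - 1) - 1) := by linarith
      rw [this, ih, h2, show -(-(n : ℤ) - 1) - 1 = (n : ℤ) by ring]
      ring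
  refine ⟨⟨fun v => by simp [hT], ⟨ha, ha1, fun k => hs _, fun m => ?_⟩, by simp [hz0]⟩, ?_⟩
  · have := hz (-m - 1)
    simp only
    rw [show -m - 1 + 1 = -m by ring] at this
    rw [show -(m + 1) = -m - 1 by ring]
    constructor <;> linarith [this.1, this.2]
  · rw [← hS]
    have hneg : ∀ x : E3, (-e.1) x = -(e.1 x) := fun x => rfl
    ext p
    simp only [dataSet, mem_setOf_eq, haggLabel_reverse, hneg]
    constructor
    · rintro ⟨m, i, j, rfl⟩
      refine ⟨-m, -i, -j, ?_⟩
      rw [← map_neg]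
      congr 1
      push_cast
      module
    · rintro ⟨m, i, j, rfl⟩
      refine ⟨-m, -i, -j, ?_⟩
      rw [← map_neg]
      congr 1
      push_cast
      rw [neg_neg]
      module

/-! ## Root energies in the `Fits` vocabulary -/

/-- **Root layer cake, `Fits` form**: for data fitting `S`,
`2·h(count|S) = Φ₀(a) + Σ'_m (if m = 0 then 0 else Φ(z m, L m))`. [folklore] -/
theorem two_mul_rootEnergy_fits {S : Set E3} {e : LData} (he : Fits S e) :
    2 * rootEnergy lennardJones ((Measure.count : Measure E3).restrict S) =
      inLayerInteraction lennardJones e.2.1 + ∑' m : ℤ, if m = 0 then (0 : ℝ) else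
        layerInteraction lennardJones e.2.1 (e.2.2.2 m) (haggLabel e.2.2.1 m) 1 := by
  obtain ⟨⟨hT, hadm, hz0⟩, hS⟩ := he
  rw [← hS, dataSet_eq_layeredSet e hT]
  exact two_mul_rootEnergy_eq hadm hz0

/-- **The competitor energy is reversal invariant**: `Φ₀ + Σ'_{m≠0} Φ(z m, L_alt m)` takes the same
value on the reversed heights `m ↦ −z(−m)`. [folklore] -/
theorem competitorEnergy_reverse (a : ℝ) (z : ℤ → ℝ) :
    (∑' m : ℤ, if m = 0 then (0 : ℝ) else
        layerInteraction lennardJones a (-z (-m)) (haggLabel alternatingHagg m) 1) =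
      ∑' m : ℤ, if m = 0 then (0 : ℝ) else
        layerInteraction lennardJones a (z m) (haggLabel alternatingHagg m) 1 := by
  rw [← Equiv.tsum_eq (Equiv.neg ℤ)]
  refine tsum_congr fun m => ?_
  simp only [Equiv.neg_apply, neg_eq_zero, neg_neg]
  split_ifs with h
  · rfl
  · rw [clo_layerInteraction_neg_height]
    congr 1
    simp only [haggLabel_alternating, even_neg]

/-! ## The symmetric fault price -/

/-- **Symmetric fault price at the root** (registered sub-goal `lms_fault_price_symmetric`).  There is
`c₀ > 0` such that for all data `e` fitting `S`, both a fault at the layer above the root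
(`s 1 ≠ −s 0`) and a fault at the layer below (`s(−2) ≠ −s(−1)`) are charged against twice the root
energy relative to the competitor energy `Φ₀(a) + Σ'_{m≠0} Φ(z m, L_alt m)`. [folklore] -/
theorem lms_fault_price_symmetric : ∃ c₀ : ℝ, 0 < c₀ ∧ ∀ (S : Set E3) (e : LData), Fits S e → c₀ * ((if e.2.2.1 1 = -e.2.2.1 0 then (0 : ℝ) else 1) + (if e.2.2.1 (-2) = -e.2.2.1 (-1) then (0 : ℝ) else 1)) ≤ 2 * (2 * rootEnergy lennardJones ((Measure.count : Measure E3).restrict S) - (inLayerInteraction lennardJones e.2.1 + ∑' m : ℤ, if m = 0 then (0 : ℝ) else layerInteraction lennardJones e.2.1 (e.2.2.2 m) (haggLabel alternatingHagg m) 1)) := by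
  obtain ⟨c₀, hc₀, hp⟩ := lms_fault_price_root
  refine ⟨c₀, hc₀, fun S e he => ?_⟩
  -- the competitor energy as twice a root energy, for `e` and for the reversed data
  have key : ∀ e' : LData, Fits S e' →
      c₀ * (if e'.2.2.1 1 = -e'.2.2.1 0 then (0 : ℝ) else 1) ≤
        2 * rootEnergy lennardJones ((Measure.count : Measure E3).restrict S) -
          (inLayerInteraction lennardJones e'.2.1 + ∑' m : ℤ, if m = 0 then (0 : ℝ) else
            layerInteraction lennardJones e'.2.1 (e'.2.2.2 m) (haggLabel alternatingHagg m) 1) := by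
    intro e' he'
    obtain ⟨⟨hT, hadm, hz0⟩, hS⟩ := he'
    have hadm' : IsAdmissibleLayering e'.2.1 alternatingHagg e'.2.2.2 :=
      ⟨hadm.1, hadm.2.1, isHaggSeq_alternating, hadm.2.2.2⟩
    have h1 := hp (frameIsometry e'.1 hT) e'.2.1 e'.2.2.1 e'.2.2.2 hadm hz0
    rw [← dataSet_eq_layeredSet e' hT, hS, two_mul_rootEnergy_eq hadm' hz0] at h1
    exact h1
  have h1 := key e he
  have h2 := key _ (reverse_fits he)
  simp only [competitorEnergy_reverse, show (-(1 : ℤ) - 1) = -2 by norm_num,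
    show (-(0 : ℤ) - 1) = -1 by norm_num] at h2
  rw [mul_add]
  split_ifs at h1 h2 ⊢ <;> linarith

/-! ## Layer `k` seen from its own points -/

/-- Re-rooted data present the set translated by a point of layer `k`:
`dataSet (rerootData e k) = layeredSet` of the re-indexed data. [folklore] -/
theorem dataSet_rerootData_eq_layeredSet (e : LData) (hT : ∀ v : E3, ‖e.1 v‖ = ‖v‖) (k : ℤ) :
    dataSet (rerootData e k) =
      layeredSet (frameIsometry e.1 hT) e.2.1 (fun m => e.2.2.1 (m + k)) (fun m => e.2.2.2 (m + k) - e.2.2.2 k) :=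
  rfl

/-- **Layer `k` energy = root energy of the re-rooted data.** [folklore] -/
theorem two_mul_rootEnergy_reroot {e : LData} (he : IsNormalData e) (k : ℤ) :
    2 * rootEnergy lennardJones ((Measure.count : Measure E3).restrict (dataSet (rerootData e k))) =
      inLayerInteraction lennardJones e.2.1 + ∑' m' : ℤ, if m' = k then (0 : ℝ) else
        layerInteraction lennardJones e.2.1 (e.2.2.2 m' - e.2.2.2 k)
          (haggLabel e.2.2.1 m' - haggLabel e.2.2.1 k) 1 := by
  obtain ⟨hT, hadm, hz0⟩ := he
  have he' : IsNormalData (rerootData e k) := isNormalData_rerootData ⟨hT, hadm, hz0⟩ k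
  have hadm' : IsAdmissibleLayering e.2.1 (fun m => e.2.2.1 (m + k))
      (fun m => e.2.2.2 (m + k) - e.2.2.2 k) := he'.2.1
  have hz0' : (fun m => e.2.2.2 (m + k) - e.2.2.2 k) 0 = 0 := he'.2.2
  rw [dataSet_rerootData_eq_layeredSet e hT k, two_mul_rootEnergy_eq hadm' hz0']
  congr 1
  rw [← Equiv.tsum_eq (Equiv.subRight k)]
  refine tsum_congr fun m' => ?_
  simp only [Equiv.subRight_apply, sub_eq_zero, sub_add_cancel, ext_haggLabel_shift]

/-- **Competitor at layer `k`**: the competitor energy of the re-rooted data is the layer-`k` term of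
the competitor's window sum (labels `L_alt m` versus `L_alt m' − L_alt k` select the same aligned /
non-aligned value). [folklore] -/
theorem competitorEnergy_reroot (a : ℝ) (z : ℤ → ℝ) (k : ℤ) :
    (∑' m : ℤ, if m = 0 then (0 : ℝ) else
        layerInteraction lennardJones a (z (m + k) - z k) (haggLabel alternatingHagg m) 1) =
      ∑' m' : ℤ, if m' = k then (0 : ℝ) else
        layerInteraction lennardJones a (z m' - z k)
          (haggLabel alternatingHagg m' - haggLabel alternatingHagg k) 1 := by
  rw [← Equiv.tsum_eq (Equiv.subRight k)]
  refine tsum_congr fun m' => ?_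
  simp only [Equiv.subRight_apply, sub_eq_zero, sub_add_cancel]
  split_ifs with h
  · rfl
  · rw [layerInteraction_eq_ite lennardJones a _ (haggLabel alternatingHagg (m' - k)),
      layerInteraction_eq_ite lennardJones a _ (haggLabel alternatingHagg m' - haggLabel alternatingHagg k)]
    have hpar : (haggLabel alternatingHagg (m' - k) % 3 = 0) ↔
        ((haggLabel alternatingHagg m' - haggLabel alternatingHagg k) % 3 = 0) := by
      simp only [haggLabel_alternating, Int.even_sub]
      by_cases h1 : Even m' <;> by_cases h2 : Even k <;> simp [h1, h2]
    by_cases hc : haggLabel alternatingHagg (m' - k) % 3 = 0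
    · rw [if_pos hc, if_pos (hpar.1 hc)]
    · rw [if_neg hc, if_neg (fun h' => hc (hpar.2 h'))]

end Summit.AtomisticToContinuum.Crystallization.Theorems.SlackRigidityPricedFloorsLayerEnergy

end
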